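import Summits.Ventures.PercRepro.ProfilePointedSeries

/-!
# PercRepro — THE COLOOP LIMIT AT ANY POINT `e`: THE EXACT CONTRACTION SPLIT
`Φ(M, p) = Φ(M ／ e, p) + #𝒦(M ／ e, p) + Σ_{X ∌ e} (2 #X − N) + Σ_{X ∈ rest(e)} (2 #X − N)`
(p10, gen 17; `proofs/P10-AVFULL.md` §25(j))

For a finite matroid `M` on `N = #E` elements, a point `p`, the captured family `𝒦 = capSets M p` and ANY non-loop
`e ≠ p`, the captured sets containing `e` split into three parts (write `Y := (E ∖ X) ∖ p`):

* `contractPart`: `e ∈ X`, `e ∉ cl (E ∖ X)` — `X ↦ X ∖ e` is a bijection onto `𝒦(M ／ e, p)`, shifting `2 #X − N`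
  by exactly `+1` (`sum_contractPart_signed`; the series theorem's `𝒦₁`, now at every `e`);
* `swapPart`: `e ∈ X`, `e ∈ cl (E ∖ X)`, `e ∉ cl Y`, `p ∉ cl (X ∖ e)` — the swap `X ↦ Y ∪ e` (`parSwap`) is an
  involution of this part reversing `2 #X − N` (`parSwap_mem_swapPart`, `sum_swapPart_signed = 0`; the series
  theorem's `𝒦₂`, now at every `e`);
* `restPart`: `e ∈ X`, `e ∈ cl (E ∖ X)`, and (`e ∈ cl Y` or `p ∈ cl (X ∖ e)`) — the obstruction.

THE IDENTITY (`sum_capSets_signed_eq_contract_split`): for every non-loop `e ≠ p`,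
`Φ(M, p) = Φ(M ／ e, p) + #𝒦(M ／ e, p) + Σ_{X ∈ 𝒦, e ∉ X} (2 #X − N) + Σ_{X ∈ restPart} (2 #X − N)`.
At a series pair `{p, e}` the two extra sums vanish (every captured set contains `e`, and the hyperplane lemmas empty
`restPart`) — the identity of ProfilePointedSeries.  At a parallel pair `{p, e}` the first extra sum is `0` too.
Census (gen 17, mining/p10/g17/ cmplus*.py, e1split.py, kit j274834 / j274853 on the `n = 9` catalogue): the
per-point bound `#𝒦(M ／ e, p) + Σ_{restPart} (2 #X − N) ≥ 0` holds for every `e` on ≤ 8 elements (58,331 tests at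
`n = 8`) but FAILS at `n = 9` (84 of 13,744,216 `(M, p, e)`), so it is not typed here; at a TRIANGLE partner `e` of `p`
(`{p, e, b}` a 3-circuit, where `p ∥ b` in `M ／ e` and so `Φ(M ／ e, p) = 0`) the stronger `Φ(M, p) ≥ #𝒦(M ／ e, p)`
survives everything (4,874 tests on ≤ 8 elements and 30,754 at `n = 9`, 0 failures — (TRI), `TriangleStep`, NOT
asserted); (TRI) would give (C1′) at every point on a triangle, the first open regime of §25(g)
(`capLimit_body_of_triangleStep`).  Nothing here asserts (TRI), (CM) or (C1′).
-/

open scoped Matroid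

namespace PercRepro.Cogirth

open Finset ThmH Skew

variable {α : Type} [DecidableEq α] {M : Matroid α} [M.Finite]

/-! ### The four parts -/

/-- The captured sets avoiding `e`. -/
noncomputable def avoidPart (M : Matroid α) [M.Finite] (p e : α) : Finset (Finset α) :=
  (capSets M p).filter (fun X => e ∉ X)

/-- The captured sets containing `e` with `e ∉ cl (E ∖ X)` — the contraction part. -/
noncomputable def contractPart (M : Matroid α) [M.Finite] (p e : α) : Finset (Finset α) :=
  (capSets M p).filter (fun X => e ∈ X ∧ e ∉ clF M (gr M \ X))

/-- The captured sets containing `e` with `e ∈ cl (E ∖ X)`, `e ∉ cl ((E ∖ X) ∖ p)` and `p ∉ cl (X ∖ e)` — the swap part. -/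
noncomputable def swapPart (M : Matroid α) [M.Finite] (p e : α) : Finset (Finset α) :=
  (capSets M p).filter (fun X => e ∈ X ∧ e ∈ clF M (gr M \ X) ∧
    (e ∉ clF M ((gr M \ X).erase p) ∧ p ∉ clF M (X.erase e)))

/-- The remaining captured sets containing `e` with `e ∈ cl (E ∖ X)` — the obstruction. -/
noncomputable def restPart (M : Matroid α) [M.Finite] (p e : α) : Finset (Finset α) :=
  (capSets M p).filter (fun X => e ∈ X ∧ e ∈ clF M (gr M \ X) ∧
    ¬ (e ∉ clF M ((gr M \ X).erase p) ∧ p ∉ clF M (X.erase e)))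

/-- The signed sum over `𝒦` is the sum over the four parts. -/
theorem sum_capSets_signed_eq_parts (p e : α) :
    ∑ X ∈ capSets M p, (2 * (X.card : ℤ) - (gr M).card) =
      ∑ X ∈ avoidPart M p e, (2 * (X.card : ℤ) - (gr M).card) +
        ∑ X ∈ contractPart M p e, (2 * (X.card : ℤ) - (gr M).card) +
        ∑ X ∈ swapPart M p e, (2 * (X.card : ℤ) - (gr M).card) +
        ∑ X ∈ restPart M p e, (2 * (X.card : ℤ) - (gr M).card) := by
  unfold avoidPart contractPart swapPart restPart
  rw [← sum_filter_add_sum_filter_not (capSets M p) (fun X => e ∉ X)]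
  have h1 : (capSets M p).filter (fun X => ¬ e ∉ X) = (capSets M p).filter (fun X => e ∈ X) := by
    apply filter_congr
    intro X _
    exact not_not
  rw [h1, ← sum_filter_add_sum_filter_not ((capSets M p).filter (fun X => e ∈ X)) (fun X => e ∉ clF M (gr M \ X)),
    filter_filter, filter_filter]
  have h2 : (capSets M p).filter (fun X => e ∈ X ∧ ¬ e ∉ clF M (gr M \ X)) =
      (capSets M p).filter (fun X => e ∈ X ∧ e ∈ clF M (gr M \ X)) := by
    apply filter_congr
    intro X _
    rw [not_not]
  rw [h2, ← sum_filter_add_sum_filter_not ((capSets M p).filter (fun X => e ∈ X ∧ e ∈ clF M (gr M \ X)))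
    (fun X => e ∉ clF M ((gr M \ X).erase p) ∧ p ∉ clF M (X.erase e)), filter_filter, filter_filter]
  have h3 : (capSets M p).filter (fun X => (e ∈ X ∧ e ∈ clF M (gr M \ X)) ∧
      (e ∉ clF M ((gr M \ X).erase p) ∧ p ∉ clF M (X.erase e))) =
      (capSets M p).filter (fun X => e ∈ X ∧ e ∈ clF M (gr M \ X) ∧
        (e ∉ clF M ((gr M \ X).erase p) ∧ p ∉ clF M (X.erase e))) := by
    apply filter_congr
    intro X _
    tauto
  have h4 : (capSets M p).filter (fun X => (e ∈ X ∧ e ∈ clF M (gr M \ X)) ∧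
      ¬ (e ∉ clF M ((gr M \ X).erase p) ∧ p ∉ clF M (X.erase e))) =
      (capSets M p).filter (fun X => e ∈ X ∧ e ∈ clF M (gr M \ X) ∧
        ¬ (e ∉ clF M ((gr M \ X).erase p) ∧ p ∉ clF M (X.erase e))) := by
    apply filter_congr
    intro X _
    tauto
  rw [h3, h4]
  ring

/-! ### The contraction part -/

/-- **THE CONTRACTION PART IS `𝒦(M ／ e, p)`**, at every non-loop `e ≠ p`: `X ↦ X ∖ e` is a bijection from
`contractPart` onto `capSets (M ／ e) p`, with `2 #X − N = (2 #(X ∖ e) − (N − 1)) + 1`. -/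
theorem sum_contractPart_signed {p e : α} (hp : p ∈ gr M) (heI : M.Indep ({e} : Set α)) (hpe' : p ≠ e) :
    ∑ X ∈ contractPart M p e, (2 * (X.card : ℤ) - (gr M).card) =
      ∑ X' ∈ capSets (M ／ ({e} : Set α)) p, ((2 * (X'.card : ℤ) - (gr (M ／ ({e} : Set α))).card) + 1) := by
  have he : e ∈ gr M := mem_gr_of_indep heI
  have hpe : p ∈ (gr M).erase e := mem_erase.2 ⟨hpe', hp⟩
  have hgr : (gr (M ／ ({e} : Set α))).card + 1 = (gr M).card := by
    rw [gr_contract', card_erase_add_one he]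
  unfold contractPart
  apply sum_nbij' (fun X => X.erase e) (fun X' => insert e X')
  · intro X hX
    rw [mem_filter] at hX
    obtain ⟨hXK, heX, hcap⟩ := hX
    obtain ⟨⟨hXb, hpX⟩, hpcl⟩ := mem_capSets.1 hXK
    obtain ⟨hXg, hXr, hXc⟩ := mem_biIndepAll.1 hXb
    have hXeg : X.erase e ⊆ (gr M).erase e := erase_subset_erase e hXg
    have hpXe : p ∉ X.erase e := fun h => hpX (mem_of_mem_erase h)
    have hZg : gr M \ X ⊆ (gr M).erase e := by
      intro z hz
      rw [mem_sdiff] at hz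
      exact mem_erase.2 ⟨fun h => hz.2 (h ▸ heX), hz.1⟩
    have h1 := rk_contract_add_one heI hXeg
    rw [insert_erase heX, hXr] at h1
    have h2 := rk_contract_add_one heI hZg
    have heZ : e ∉ gr M \ X := fun h => (mem_sdiff.1 h).2 heX
    rw [rk_insert_eq_card_of_notMem_clF he sdiff_subset hXc heZ hcap, card_insert_of_notMem heZ] at h2
    have h3 := rk_contract_add_one heI (insert_subset hpe hXeg)
    rw [insert_comm, insert_erase heX, (mem_clF_iff_rk_insert_eq hp hXg).1 hpcl, hXr] at h3
    rw [mem_capSets, mem_biIndepAll, gr_contract', gr_erase_sdiff_erase_of_mem_series heX]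
    refine ⟨⟨⟨hXeg, ?_, ?_⟩, hpXe⟩, ?_⟩
    · rw [card_erase_of_mem heX]
      omega
    · omega
    · rw [mem_clF_iff_rk_insert_eq (M := M ／ ({e} : Set α)) (by rw [gr_contract']; exact hpe)
        (by rw [gr_contract']; exact hXeg)]
      omega
  · intro X' hX'
    rw [mem_capSets, mem_biIndepAll, gr_contract'] at hX'
    obtain ⟨⟨⟨hX'g, hX'r, hX'c⟩, hpX'⟩, hpcl'⟩ := hX'
    have heX' : e ∉ X' := fun h => (mem_erase.1 (hX'g h)).1 rfl
    have hX'g0 : X' ⊆ gr M := fun x hx => (mem_erase.1 (hX'g hx)).2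
    have hcomp : gr M \ insert e X' = (gr M).erase e \ X' := by
      rw [sdiff_insert, erase_sdiff]
    have hZ'g : (gr M).erase e \ X' ⊆ (gr M).erase e := sdiff_subset
    have heZ' : e ∉ (gr M).erase e \ X' := fun h => (mem_erase.1 (mem_sdiff.1 h).1).1 rfl
    have h1 := rk_contract_add_one heI hX'g
    rw [hX'r] at h1
    have h2 := rk_contract_add_one heI hZ'g
    rw [hX'c] at h2
    have h3 := rk_contract_add_one heI (insert_subset hpe hX'g)
    rw [mem_clF_iff_rk_insert_eq (M := M ／ ({e} : Set α)) (by rw [gr_contract']; exact hpe)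
        (by rw [gr_contract']; exact hX'g), hX'r] at hpcl'
    rw [hpcl'] at h3
    have h4 := rk_insert_le (M := M) e ((gr M).erase e \ X')
    have h5 := rk_le_card (M := M) ((gr M).erase e \ X')
    have hZ'r : rk M ((gr M).erase e \ X') = ((gr M).erase e \ X').card := by omega
    rw [mem_filter, mem_capSets, mem_biIndepAll, hcomp]
    refine ⟨⟨⟨⟨insert_subset he hX'g0, ?_, hZ'r⟩, ?_⟩, ?_⟩, mem_insert_self e X', ?_⟩
    · rw [card_insert_of_notMem heX']
      omega
    · rw [mem_insert, not_or]
      exact ⟨hpe', hpX'⟩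
    · rw [mem_clF_iff_rk_insert_eq hp (insert_subset he hX'g0), insert_comm]
      omega
    · rw [mem_clF_iff_rk_insert_eq he (sdiff_subset.trans (erase_subset _ _))]
      omega
  · intro X hX
    rw [mem_filter] at hX
    exact insert_erase hX.2.1
  · intro X' hX'
    rw [mem_capSets, mem_biIndepAll, gr_contract'] at hX'
    exact erase_insert (fun h => (mem_erase.1 (hX'.1.1.1 h)).1 rfl)
  · intro X hX
    rw [mem_filter] at hX
    have heX : e ∈ X := hX.2.1
    rw [card_erase_of_mem heX]
    have h0 : 0 < X.card := card_pos.2 ⟨e, heX⟩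
    have h1 : ((X.card - 1 : ℕ) : ℤ) = (X.card : ℤ) - 1 := by
      rw [Nat.cast_sub h0]
      simp
    have h2 : ((gr (M ／ ({e} : Set α))).card : ℤ) = (gr M).card - 1 := by
      have := hgr
      omega
    rw [h1, h2]
    ring

/-! ### The swap part -/

/-- **THE SWAP PRESERVES `swapPart`** at every non-loop `e ≠ p`. -/
theorem parSwap_mem_swapPart {p e : α} (hp : p ∈ gr M) (he : e ∈ gr M) (hpe' : p ≠ e) {X : Finset α}
    (hX : X ∈ swapPart M p e) : parSwap M p e X ∈ swapPart M p e := by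
  unfold swapPart at hX ⊢
  rw [mem_filter] at hX
  obtain ⟨hXK, heX, hcap, heY, hpXe⟩ := hX
  obtain ⟨⟨hXb, hpX⟩, hpcl⟩ := mem_capSets.1 hXK
  obtain ⟨hXg, hXr, hXc⟩ := mem_biIndepAll.1 hXb
  have hpZ : p ∈ gr M \ X := mem_sdiff.2 ⟨hp, hpX⟩
  set Y := (gr M \ X).erase p with hYdef
  have hYg : Y ⊆ gr M := (erase_subset _ _).trans sdiff_subset
  have heY' : e ∉ Y := fun h => (mem_sdiff.1 (mem_of_mem_erase h)).2 heX
  have hpY : p ∉ Y := notMem_erase p _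
  have hZ : insert p Y = gr M \ X := insert_erase hpZ
  have hYr : rk M Y = Y.card := rk_eq_card_of_subset_of_rk_eq_card (erase_subset _ _) hXc
  have hreY : rk M (insert e Y) = (insert e Y).card := rk_insert_eq_card_of_notMem_clF he hYg hYr heY' heY
  have hcomp : gr M \ insert e Y = insert p (X.erase e) := by
    rw [sdiff_insert, hYdef, sdiff_sdiff_erase hp hXg hpX, erase_insert_of_ne hpe']
  have hXeg : X.erase e ⊆ gr M := (erase_subset _ _).trans hXg
  have hpXe' : p ∉ X.erase e := fun h => hpX (mem_of_mem_erase h)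
  have hXer : rk M (X.erase e) = (X.erase e).card := rk_eq_card_of_subset_of_rk_eq_card (erase_subset _ _) hXr
  have hrpXe : rk M (insert p (X.erase e)) = (insert p (X.erase e)).card :=
    rk_insert_eq_card_of_notMem_clF hp hXeg hXer hpXe' hpXe
  have hcapY : rk M (insert e (insert p Y)) = rk M (insert p Y) := by
    rw [hZ]
    exact (mem_clF_iff_rk_insert_eq he sdiff_subset).1 hcap
  have hpcl' : p ∈ clF M (insert e Y) := by
    rw [mem_clF_iff_rk_insert_eq hp (insert_subset he hYg), insert_comm, hcapY, hZ, hXc, ← hZ,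
      card_insert_of_notMem hpY, hreY, card_insert_of_notMem heY']
  have hXpos : 0 < X.card := card_pos.2 ⟨e, heX⟩
  unfold parSwap
  rw [← hYdef, mem_filter, mem_capSets, mem_biIndepAll]
  refine ⟨⟨⟨⟨insert_subset he hYg, hreY, ?_⟩, ?_⟩, hpcl'⟩, mem_insert_self e Y, ?_, ?_, ?_⟩
  · rw [hcomp]
    exact hrpXe
  · rw [mem_insert, not_or]
    exact ⟨hpe', hpY⟩
  · -- `e ∈ cl (E ∖ (Y ∪ e)) = cl (p ∪ (X ∖ e))`
    rw [hcomp, mem_clF_iff_rk_insert_eq he (insert_subset hp hXeg), hrpXe, insert_comm, insert_erase heX,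
      (mem_clF_iff_rk_insert_eq hp hXg).1 hpcl, hXr, card_insert_of_notMem hpXe', card_erase_of_mem heX]
    omega
  · -- `e ∉ cl ((E ∖ (Y ∪ e)) ∖ p) = cl (X ∖ e)`
    rw [hcomp, erase_insert hpXe', mem_clF_iff_rk_insert_eq he hXeg, insert_erase heX, hXr, hXer,
      card_erase_of_mem heX]
    omega
  · -- `p ∉ cl ((Y ∪ e) ∖ e) = cl Y`
    rw [erase_insert heY', mem_clF_iff_rk_insert_eq hp hYg, hZ, hXc, ← hZ, card_insert_of_notMem hpY, hYr]
    omega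

/-- The swap is an involution on `swapPart`. -/
theorem parSwap_parSwap_swapPart {p e : α} (hp : p ∈ gr M) (hpe' : p ≠ e) {X : Finset α}
    (hX : X ∈ swapPart M p e) : parSwap M p e (parSwap M p e X) = X := by
  unfold swapPart at hX
  rw [mem_filter] at hX
  obtain ⟨hXK, heX, -⟩ := hX
  obtain ⟨⟨hXb, hpX⟩, -⟩ := mem_capSets.1 hXK
  have hXg : X ⊆ gr M := (mem_biIndepAll.1 hXb).1
  unfold parSwap
  rw [sdiff_insert, sdiff_sdiff_erase hp hXg hpX, erase_insert_of_ne hpe',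
    erase_insert (fun h => hpX (mem_of_mem_erase h)), insert_erase heX]

/-- `#(parSwap X) + #X = N` on `swapPart`. -/
theorem card_parSwap_add_swapPart {p e : α} (hp : p ∈ gr M) {X : Finset α} (hX : X ∈ swapPart M p e) :
    (parSwap M p e X).card + X.card = (gr M).card := by
  unfold swapPart at hX
  rw [mem_filter] at hX
  obtain ⟨hXK, heX, -⟩ := hX
  have heY : e ∉ (gr M \ X).erase p := fun h => (mem_sdiff.1 (mem_of_mem_erase h)).2 heX
  unfold parSwap
  rw [card_insert_of_notMem heY]
  have := card_pSide_add hp hXK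
  omega

/-- **THE SWAP PART SUMS TO ZERO**: `Σ_{X ∈ swapPart} (2 #X − N) = 0`. -/
theorem sum_swapPart_signed {p e : α} (hp : p ∈ gr M) (he : e ∈ gr M) (hpe' : p ≠ e) :
    ∑ X ∈ swapPart M p e, (2 * (X.card : ℤ) - (gr M).card) = 0 := by
  apply sum_involution (fun X _ => parSwap M p e X)
  · intro X hX
    have h := card_parSwap_add_swapPart hp hX
    have h' : ((parSwap M p e X).card : ℤ) + X.card = (gr M).card := by exact_mod_cast h
    linarith
  · intro X hX hne heq
    have h := card_parSwap_add_swapPart hp hX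
    rw [heq] at h
    apply hne
    have h' : (X.card : ℤ) + X.card = (gr M).card := by exact_mod_cast h
    linarith
  · intro X hX
    exact parSwap_mem_swapPart hp he hpe' hX
  · intro X hX
    exact parSwap_parSwap_swapPart hp hpe' hX

/-! ### The identity -/

/-- **THE CONTRACTION SPLIT OF THE COLOOP LIMIT AT ANY POINT**: for every non-loop `e ≠ p`,
`Φ(M, p) = Φ(M ／ e, p) + #𝒦(M ／ e, p) + Σ_{X ∈ 𝒦, e ∉ X} (2 #X − N) + Σ_{X ∈ restPart} (2 #X − N)`. -/
theorem sum_capSets_signed_eq_contract_split {p e : α} (hp : p ∈ gr M) (heI : M.Indep ({e} : Set α))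
    (hpe' : p ≠ e) :
    ∑ X ∈ capSets M p, (2 * (X.card : ℤ) - (gr M).card) =
      ∑ X' ∈ capSets (M ／ ({e} : Set α)) p, (2 * (X'.card : ℤ) - (gr (M ／ ({e} : Set α))).card) +
        (capSets (M ／ ({e} : Set α)) p).card +
        ∑ X ∈ avoidPart M p e, (2 * (X.card : ℤ) - (gr M).card) +
        ∑ X ∈ restPart M p e, (2 * (X.card : ℤ) - (gr M).card) := by
  have he : e ∈ gr M := mem_gr_of_indep heI
  rw [sum_capSets_signed_eq_parts p e, sum_contractPart_signed hp heI hpe', sum_swapPart_signed hp he hpe',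
    sum_add_distrib, sum_const, nsmul_eq_mul, mul_one]
  ring

/-- **(TRI) (NOT asserted)**: at a triangle `{p, e, b}` through `p`, `Φ(M, p) ≥ #𝒦(M ／ e, p)`. -/
def TriangleStep (α : Type) [DecidableEq α] : Prop :=
  ∀ (M : Matroid α) [M.Finite] (p e b : α), p ∈ gr M → e ∈ gr M → b ∈ gr M → p ≠ e → p ≠ b → e ≠ b →
    rk M {p, e} = 2 → rk M {p, b} = 2 → rk M {e, b} = 2 → rk M {p, e, b} = 2 →
    ((capSets (M ／ ({e} : Set α)) p).card : ℤ) ≤ ∑ X ∈ capSets M p, (2 * (X.card : ℤ) - (gr M).card)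

/-- (TRI) gives (C1′) at every point on a triangle. -/
theorem capLimit_body_of_triangleStep (h : TriangleStep α) {p e b : α} (hp : p ∈ gr M) (he : e ∈ gr M)
    (hb : b ∈ gr M) (hpe : p ≠ e) (hpb : p ≠ b) (heb : e ≠ b) (h1 : rk M {p, e} = 2) (h2 : rk M {p, b} = 2)
    (h3 : rk M {e, b} = 2) (h4 : rk M {p, e, b} = 2) :
    (gr M).card * ∑ k ∈ range ((gr M).card + 1), capCount M k p ≤
      2 * ∑ k ∈ range ((gr M).card + 1), k * capCount M k p := by
  rw [capLimit_body_iff_sum_nonneg]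
  have := h M p e b hp he hb hpe hpb heb h1 h2 h3 h4
  have h0 : (0 : ℤ) ≤ (capSets (M ／ ({e} : Set α)) p).card := by exact_mod_cast Nat.zero_le _
  linarith

end PercRepro.Cogirth
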